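import Literature.MathematicalPhysics.QuantumFieldTheory.Chatterjee2019LargeN.AreaLowerBound
import Mathlib.Data.ZMod.Basic
import HarnessLib

/-!
# Chatterjee 2019, §4/§14: the parity selection rule — `a_k((l)) = 0` unless `k ≡ area(l) (mod 2)`; `a₂((p)) = a₄((p)) = 0`

S. Chatterjee, *Rigorous solution of strongly coupled `SO(N)` lattice gauge theory in the large `N` limit*,
Comm. Math. Phys. **366** (2019) 203–268 (arXiv:1502.07719).  **§4** (last paragraph) prints the first six
strong-coupling coefficients of the plaquette loop `(p)` in `ℤ³`: «`a₀ = 0, a₁ = 1, a₂ = a₃ = a₄ = 0, a₅ = −7`»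
(the tree's named fact `PlaquetteCoefficientsZ3`; rows `k = 0` and `k = 1` are the tree theorems
`coeffA_plaquette_zero`, `coeffA_plaquette_one`).  **§14** (proof of Lemma 14.1) follows the 1-chain `r(s)` of a loop
sequence along a vanishing trajectory: it is unchanged by a splitting and changes by `±δq` under a deformation by the
plaquette `q`, so that `r(s₀) = δx` for the lattice surface `x = Σⱼ σⱼ qⱼ` swept out by the trajectory
(tree: `LoopSeq.seqChain_posSplitAt/negSplitAt/posDeformAt/negDeformAt`, `Trajectory.exists_surface`).

This file adds the PARITY refinement of that bookkeeping and proves the rows `k = 2` and `k = 4` of the printed table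
in every dimension.  The device is the `ℤ`-linear functional `ψ` on 1-chains with `ψ(x, i) = Σ_{m<i} x_m (mod 2)`
(`edgeParity`, `chainParity`): for every plaquette `q = (y; i < j)` one has
`ψ(δq) = ψ(y,j) + ψ(y+eⱼ,i) − ψ(y+eᵢ,j) − ψ(y,i) ≡ 1 (mod 2)` (`chainParity_plaquetteChain`), hence `ψ(δx) ≡ Σ_q x_q ≡ area(x)
(mod 2)` for every lattice surface `x` (`chainParity_boundary`), and along a vanishing trajectory `X` of `s` the count
`δ(X)` of deformations satisfies `δ(X) ≡ ψ(r(s)) (mod 2)` (`Trajectory.numDeform_parity`).  Consequences, all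
hypothesis-free:
* `Trajectory.numDeform_parity_eq_surfaceArea` — `δ(X) ≡ area(x) (mod 2)` for EVERY lattice surface `x` with `δx = r(s)`
  (so all spanning surfaces of a loop have the same area parity, that of its minimal area);
* `coeffA_eq_zero_of_parity`, ★ `coeffA_singleton_eq_zero_of_parity_area` — **`a_k((l)) = 0` whenever
  `k ≢ area(l) (mod 2)`** (with Lemma 14.1, `a_k((l)) = 0` for `k < area(l)`: the series of Corollary 3.5 for a single
  loop is `β^{area(l)} (a_{area} + a_{area+2} β² + ⋯)`);
* ★ `coeffA_plaquette_of_even` — `a_k((p)) = 0` for every even `k` and every plaquette `p` of `ℤᵈ`; in particular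
  `coeffA_plaquette_two`, `coeffA_plaquette_four` and the rows `plaquetteCoefficientsZ3_two`, `plaquetteCoefficientsZ3_four`
  of the printed table («`a₂ = 0`», «`a₄ = 0`»).

## WHAT THIS IS NOT
The rows `k = 3` (`a₃ = 0`) and `k = 5` (`a₅ = −7`, a computer enumeration in the source) of `PlaquetteCoefficientsZ3`
are not touched by a parity argument and remain open; nothing here bears on four-dimensional Yang–Mills or a mass gap.

## References
* S. Chatterjee, Comm. Math. Phys. **366** (2019) 203–268, doi:10.1007/s00220-019-03353-3, arXiv:1502.07719 — §3
  (1-chains `r`, the differential `δ`, lattice surfaces and `area`), §4 (last paragraph: the printed coefficients),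
  §14 (proof of Lemma 14.1: `r` along a trajectory), Corollary 3.5 (`a_k(s)`).  [Chatterjee2019LargeN]
-/

noncomputable section

open Finset
open Literature.Probability.LatticeModels Literature.MathematicalPhysics.QuantumLattice

namespace Literature.MathematicalPhysics.QuantumFieldTheory.Chatterjee2019LargeN

variable {d : ℕ}

/-! ### The parity functional `ψ` on 1-chains -/

/-- The parity weight `π(x, i) = Σ_{m < i} x_m (mod 2)` of the (positively oriented) edge `(x, i)` of `ℤᵈ` — the
device by which the 1-chain bookkeeping of §14 is read modulo `2` (`π` takes the value `1 (mod 2)` on `δq` for every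
plaquette `q`, `chainParity_plaquetteChain`). [cite: Chatterjee2019LargeN, §3 (1-chains over E⁺), §14 (proof of Lemma 14.1)] -/
def edgeParity (e : ZdEdge d) : ZMod 2 :=
  ∑ m ∈ univ.filter (fun m : Fin d => m < e.2), ((e.1 m : ℤ) : ZMod 2)

/-- The `ℤ`-linear parity functional `ψ(c) = Σ_e c(e) π(e) (mod 2)` on 1-chains `c = Σ_e c(e) e`.
[cite: Chatterjee2019LargeN, §3 (1-chains: the free ℤ-module over E⁺), §14 (proof of Lemma 14.1)] -/
def chainParity : (ZdEdge d →₀ ℤ) →+ ZMod 2 :=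
  Finsupp.liftAddHom fun e => (AddMonoidHom.mulRight (edgeParity e)).comp (Int.castAddHom (ZMod 2))

/-- `ψ(n·e) = n π(e)`. [cite: Chatterjee2019LargeN, §3 (1-chains)] -/
theorem chainParity_single (e : ZdEdge d) (n : ℤ) :
    chainParity (Finsupp.single e n) = (n : ZMod 2) * edgeParity e := by
  simp [chainParity]

/-- `a + a = 0` in `ℤ/2`. [cite: Chatterjee2019LargeN, §14 (bookkeeping mod 2)] -/
private theorem zmod2_add_self (a : ZMod 2) : a + a = 0 := by
  have h : ∀ b : ZMod 2, b + b = 0 := by decide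
  exact h a

/-- Shifting the base point by `eᵢ` changes `π(·, j)` by `𝟙[i < j]`. [cite: Chatterjee2019LargeN, §3 (the edges of a plaquette)] -/
theorem edgeParity_add_single (y : Literature.Probability.LatticeModels.Site d) (i j : Fin d) :
    edgeParity (y + Pi.single i (1 : ℤ), j) = edgeParity (y, j) + if i < j then 1 else 0 := by
  unfold edgeParity
  simp only [Pi.add_apply, Pi.single_apply, Int.cast_add, Int.cast_ite, Int.cast_one, Int.cast_zero,
    Finset.sum_add_distrib, Finset.sum_ite_eq', Finset.mem_filter, Finset.mem_univ, true_and]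

/-- `ψ(r(e)) = π(e)` for a directed edge `e` of either orientation (`−1 ≡ 1`). [cite: Chatterjee2019LargeN, §3 (r(e) = ±e)] -/
theorem chainParity_edgeChain (a : DEdge d) : chainParity (edgeChain a) = edgeParity a.1 := by
  unfold edgeChain
  rw [chainParity_single]
  cases a.2
  · simp only [Bool.false_eq_true, if_false, Int.cast_neg, Int.cast_one, neg_mul, one_mul]
    exact ZMod.neg_eq_self_mod_two _
  · simp

/-- **`ψ(δq) ≡ 1 (mod 2)` for every plaquette `q`**: with `q = (y; i < j)`, `δq = (y,j) + (y+eⱼ,i) − (y+eᵢ,j) − (y,i)` and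
`π(y+eⱼ,i) = π(y,i)`, `π(y+eᵢ,j) = π(y,j) + 1`. [cite: Chatterjee2019LargeN, §3 (δp = e₁ + e₂ − e₃ − e₄)] -/
theorem chainParity_plaquetteChain (q : ZdPlaquette d) : chainParity (plaquetteChain q) = 1 := by
  obtain ⟨y, ⟨⟨i, j⟩, hij⟩⟩ := q
  have hij' : i < j := hij
  have hji : ¬ j < i := lt_asymm hij'
  simp only [plaquetteChain, plaquetteWord, wordChain_cons, wordChain_nil, map_add, add_zero,
    chainParity_edgeChain, edgeParity_add_single, if_pos hij', if_neg hji]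
  linear_combination zmod2_add_self (edgeParity ((y, j) : ZdEdge d)) + zmod2_add_self (edgeParity ((y, i) : ZdEdge d))

/-- `ψ(σ δq) = 1` for `σ = ±1`. [cite: Chatterjee2019LargeN, §14 (r changes by ±δq under a deformation)] -/
theorem chainParity_smul_plaquetteChain (q : ZdPlaquette d) {σ : ℤ} (hσ : σ = 1 ∨ σ = -1) :
    chainParity (σ • plaquetteChain q) = 1 := by
  rw [map_zsmul, chainParity_plaquetteChain, zsmul_eq_mul, mul_one]
  rcases hσ with rfl | rfl
  · simp
  · rw [Int.cast_neg, Int.cast_one]; exact ZMod.neg_eq_self_mod_two _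

/-- **`ψ(δx) ≡ area(x) (mod 2)`**: for a lattice surface `x = Σ_q x_q q`, `ψ(δx) = Σ_q x_q (mod 2)`.
[cite: Chatterjee2019LargeN, §3 (δ extended linearly; area(x) = Σ|x_q|)] -/
theorem chainParity_boundary (x : ZdPlaquette d →₀ ℤ) : chainParity (boundary x) = x.sum fun _ n => (n : ZMod 2) := by
  rw [boundary, Finsupp.linearCombination_apply, map_finsuppSum]
  refine Finsupp.sum_congr fun q _ => ?_
  rw [map_zsmul, chainParity_plaquetteChain, zsmul_eq_mul, mul_one]

/-- `|n| ≡ n (mod 2)`. [cite: Chatterjee2019LargeN, §3 (area(x) = Σ |x_q|)] -/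
private theorem natAbs_cast_zmod2 (n : ℤ) : ((n.natAbs : ℕ) : ZMod 2) = (n : ZMod 2) := by
  rcases Int.natAbs_eq n with h | h
  · conv_rhs => rw [h]
    simp
  · conv_rhs => rw [h]
    rw [Int.cast_neg, ZMod.neg_eq_self_mod_two]
    simp

/-- `area(x) ≡ Σ_q x_q (mod 2)`. [cite: Chatterjee2019LargeN, §3 (area of a lattice surface)] -/
theorem surfaceArea_cast_zmod2 (x : ZdPlaquette d →₀ ℤ) : ((surfaceArea x : ℕ) : ZMod 2) = x.sum fun _ n => (n : ZMod 2) := by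
  unfold surfaceArea Finsupp.sum
  rw [Nat.cast_sum]
  exact Finset.sum_congr rfl fun q _ => natAbs_cast_zmod2 _

/-- Hence `ψ(δx) ≡ area(x) (mod 2)` for every lattice surface `x`. [cite: Chatterjee2019LargeN, §3 (lattice surfaces)] -/
theorem chainParity_boundary_eq_surfaceArea (x : ZdPlaquette d →₀ ℤ) :
    chainParity (boundary x) = ((surfaceArea x : ℕ) : ZMod 2) := by
  rw [chainParity_boundary, surfaceArea_cast_zmod2]

/-! ### Parity of the number of deformations along a vanishing trajectory -/

/-- **One move**: `ψ(r(s)) = ψ(r(s')) + 𝟙[the move is a deformation] (mod 2)` — a splitting keeps `r`, a deformation by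
`q` changes it by `±δq` and `ψ(±δq) = 1`. [cite: Chatterjee2019LargeN, §14, proof of Lemma 14.1 («if s' is a splitting of s, then r(s) = r(s')»; r(l ⊕ l') = r(l) ± r(l'))] -/
theorem Move.chainParity_seqChain {s : LoopSeq d} (m : Move s) :
    chainParity (LoopSeq.seqChain s) = chainParity (LoopSeq.seqChain m.result) + if m.isDeform then 1 else 0 := by
  have h11 : (1 : ZMod 2) + 1 = 0 := zmod2_add_self 1
  cases m with
  | posDeform o =>
    obtain ⟨σ, hσ, hc⟩ := LoopSeq.seqChain_posDeformAt s o
    rw [Move.result, hc, map_add, chainParity_smul_plaquetteChain _ hσ, Move.isDeform, if_pos rfl, add_assoc, h11,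
      add_zero]
  | negDeform o =>
    obtain ⟨σ, hσ, hc⟩ := LoopSeq.seqChain_negDeformAt s o
    rw [Move.result, hc, map_add, chainParity_smul_plaquetteChain _ hσ, Move.isDeform, if_pos rfl, add_assoc, h11,
      add_zero]
  | posSplit o =>
    rw [Move.result, LoopSeq.seqChain_posSplitAt, Move.isDeform]
    simp
  | negSplit o =>
    rw [Move.result, LoopSeq.seqChain_negSplitAt, Move.isDeform]
    simp

/-- ★ **Parity of the deformation count**: along every vanishing trajectory `X` of `s`, `δ(X) ≡ ψ(r(s)) (mod 2)`
(induction on the moves; `r(∅) = 0`). [cite: Chatterjee2019LargeN, §14, proof of Lemma 14.1 (r(s₀) = δx for the surface swept by X), §2.2 (δ(X))] -/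
theorem Trajectory.numDeform_parity : ∀ {s : LoopSeq d} (X : Trajectory s),
    ((X.numDeform : ℕ) : ZMod 2) = chainParity (LoopSeq.seqChain s)
  | _, Trajectory.nil => by simp [Trajectory.numDeform]
  | _, Trajectory.cons m X => by
    rw [Trajectory.numDeform, Nat.cast_add, Trajectory.numDeform_parity X, Move.chainParity_seqChain m, add_comm]
    split_ifs <;> simp

/-- **All spanning surfaces have the parity of the deformation count**: if `δx = r(s)` then `δ(X) ≡ area(x) (mod 2)` for
every vanishing trajectory `X` of `s`. [cite: Chatterjee2019LargeN, §14, proof of Lemma 14.1; §3 (area(x))] -/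
theorem Trajectory.numDeform_parity_eq_surfaceArea {s : LoopSeq d} (X : Trajectory s) {x : ZdPlaquette d →₀ ℤ}
    (hx : boundary x = LoopSeq.seqChain s) : ((X.numDeform : ℕ) : ZMod 2) = ((surfaceArea x : ℕ) : ZMod 2) := by
  rw [X.numDeform_parity, ← hx, chainParity_boundary_eq_surfaceArea]

/-- `𝒳ₖ(s)` is empty when `k ≢ ψ(r(s)) (mod 2)`. [cite: Chatterjee2019LargeN, §2.2 (𝒳ₖ(s)), §14] -/
theorem isEmpty_trajectoryWith_of_parity {s : LoopSeq d} {k : ℕ}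
    (hk : ((k : ℕ) : ZMod 2) ≠ chainParity (LoopSeq.seqChain s)) : IsEmpty (TrajectoryWith s k) :=
  ⟨fun X => hk (by rw [← X.2]; exact X.1.numDeform_parity)⟩

/-- **Parity selection rule for the coefficients**: `a_k(s) = 0` when `k ≢ ψ(r(s)) (mod 2)`.
[cite: Chatterjee2019LargeN, Corollary 3.5 (a_k(s) = Σ_{𝒳ₖ(s)} v(X)), §14] -/
theorem coeffA_eq_zero_of_parity {s : LoopSeq d} {k : ℕ} (hk : ((k : ℕ) : ZMod 2) ≠ chainParity (LoopSeq.seqChain s)) :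
    coeffA s k = 0 := by
  haveI := isEmpty_trajectoryWith_of_parity hk
  exact tsum_empty

/-- Single loops: `a_k((l)) = 0` when `k ≢ ψ(r(l)) (mod 2)`. [cite: Chatterjee2019LargeN, Corollary 3.5, §14] -/
theorem coeffA_singleton_eq_zero_of_parity (l : Word d) {k : ℕ} (hk : ((k : ℕ) : ZMod 2) ≠ chainParity (wordChain l)) :
    coeffA [l] k = 0 :=
  coeffA_eq_zero_of_parity (by rwa [LoopSeq.seqChain_cons, LoopSeq.seqChain_nil, add_zero])

/-- If some lattice surface bounds `l`, the minimal area is attained: `area(l) = area(x₀)` with `δx₀ = r(l)`.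
[cite: Chatterjee2019LargeN, §3 («area(l) is well-defined»: the minimum over spanning surfaces)] -/
theorem exists_surface_area_eq (l : Word d) {x : ZdPlaquette d →₀ ℤ} (hx : IsBoundaryOf l x) :
    ∃ x₀ : ZdPlaquette d →₀ ℤ, IsBoundaryOf l x₀ ∧ surfaceArea x₀ = area l := by
  have hne : {A : ℕ | ∃ x : ZdPlaquette d →₀ ℤ, IsBoundaryOf l x ∧ surfaceArea x = A}.Nonempty := ⟨_, x, hx, rfl⟩
  obtain ⟨x₀, hx₀, hA⟩ := Nat.sInf_mem hne
  exact ⟨x₀, hx₀, hA⟩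

/-- ★ **`a_k((l)) = 0` unless `k ≡ area(l) (mod 2)`** — the parity companion of Lemma 14.1 (`a_k((l)) = 0` for
`k < area(l)`): a vanishing trajectory of `(l)` with `k` deformations sweeps out a surface `x` with `δx = r(l)` and
`area(x) ≡ k`, while every spanning surface, in particular a minimal one, has `area ≡ ψ(r(l)) (mod 2)`.
[cite: Chatterjee2019LargeN, Lemma 14.1 and its proof (§14); §3 (area(l)); §4 (a₂ = a₄ = 0 for the plaquette)] -/
theorem coeffA_singleton_eq_zero_of_parity_area (l : Word d) {k : ℕ} (hk : k % 2 ≠ area l % 2) : coeffA [l] k = 0 := by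
  by_contra hne
  have hX : Nonempty (TrajectoryWith [l] k) := by
    by_contra h
    rw [not_nonempty_iff] at h
    exact hne tsum_empty
  obtain ⟨X, hXk⟩ := hX
  obtain ⟨x, hx, -⟩ := Trajectory.exists_surface X
  rw [LoopSeq.seqChain_cons, LoopSeq.seqChain_nil, add_zero] at hx
  obtain ⟨x₀, hx₀, hA⟩ := exists_surface_area_eq l (x := x) hx
  have h1 := X.numDeform_parity_eq_surfaceArea (x := x₀) (by rw [LoopSeq.seqChain_cons, LoopSeq.seqChain_nil, add_zero]; exact hx₀)
  rw [hXk, hA, ZMod.natCast_eq_natCast_iff'] at h1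
  exact hk h1

/-! ### The plaquette: `a_k((p)) = 0` for every even `k` (rows `k = 2, 4` of the printed table) -/

/-- `ψ(r(∂p)) = ψ(δp) = 1`. [cite: Chatterjee2019LargeN, §3 (δp = r of the plaquette word)] -/
theorem chainParity_wordChain_plaquetteWord (p : ZdPlaquette d) : chainParity (wordChain (plaquetteWord p)) = 1 :=
  chainParity_plaquetteChain p

/-- ★ **`a_k((p)) = 0` for every EVEN `k` and every plaquette `p` of `ℤᵈ`** (any `d`): a vanishing trajectory of the
plaquette loop uses an odd number of deformations (`δ(X) ≡ ψ(δp) = 1`).  For `d = 3` and `k = 0, 2, 4` these are the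
printed «`a₀ = 0`», «`a₂ = 0`», «`a₄ = 0`». [cite: Chatterjee2019LargeN, §4 (last paragraph), §14] -/
theorem coeffA_plaquette_of_even (p : ZdPlaquette d) {k : ℕ} (hk : Even k) : coeffA [plaquetteWord p] k = 0 := by
  refine coeffA_singleton_eq_zero_of_parity _ ?_
  rw [chainParity_wordChain_plaquetteWord, (ZMod.natCast_eq_zero_iff_even).2 hk]
  exact zero_ne_one

/-- **`a₂((p)) = 0`** («`a₂ = 0`»), every `d`. [cite: Chatterjee2019LargeN, §4 (last paragraph)] -/
theorem coeffA_plaquette_two (p : ZdPlaquette d) : coeffA [plaquetteWord p] 2 = 0 :=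
  coeffA_plaquette_of_even p (by decide)

/-- **`a₄((p)) = 0`** («`a₄ = 0`»), every `d`. [cite: Chatterjee2019LargeN, §4 (last paragraph)] -/
theorem coeffA_plaquette_four (p : ZdPlaquette d) : coeffA [plaquetteWord p] 4 = 0 :=
  coeffA_plaquette_of_even p (by decide)

/-- The `k = 2` row of the printed table (`PlaquetteCoefficientsZ3`): `a₂((p)) = 0` for a plaquette of `ℤ³`.
[cite: Chatterjee2019LargeN, §4 (last paragraph: a₂ = 0)] -/
theorem plaquetteCoefficientsZ3_two (p : ZdPlaquette 3) : coeffA [plaquetteWord p] 2 = (plaquetteCoeffZ3 2 : ℝ) := by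
  rw [coeffA_plaquette_two]
  simp [plaquetteCoeffZ3]

/-- The `k = 4` row of the printed table (`PlaquetteCoefficientsZ3`): `a₄((p)) = 0` for a plaquette of `ℤ³`.
[cite: Chatterjee2019LargeN, §4 (last paragraph: a₄ = 0)] -/
theorem plaquetteCoefficientsZ3_four (p : ZdPlaquette 3) : coeffA [plaquetteWord p] 4 = (plaquetteCoeffZ3 4 : ℝ) := by
  rw [coeffA_plaquette_four]
  simp [plaquetteCoeffZ3]

/-- The even rows of the printed table hold for every even `k` (`plaquetteCoeffZ3 k = 0` for even `k`).
[cite: Chatterjee2019LargeN, §4 (last paragraph)] -/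
theorem plaquetteCoefficientsZ3_of_even (p : ZdPlaquette 3) {k : ℕ} (hk : Even k) :
    coeffA [plaquetteWord p] k = (plaquetteCoeffZ3 k : ℝ) := by
  rw [coeffA_plaquette_of_even p hk]
  have h1 : k ≠ 1 := fun h => by subst h; exact absurd hk (by decide)
  have h5 : k ≠ 5 := fun h => by subst h; exact absurd hk (by decide)
  simp [plaquetteCoeffZ3, h1, h5]

end Literature.MathematicalPhysics.QuantumFieldTheory.Chatterjee2019LargeN

end
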